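/-
Copyright (c) 2026 the pub-hodgecm-mathlib formalisation cell (harness21).  Prover seat hodgecm-mathlib-K2E5-p04 (g3), HCML Track B «K2-LIT» (build stream 29),
h413 = `stmt-HodgeConjecture-24833`, line `K2_E3_EllipticInputs`, unit U12 «Characters», socket #11 road (11-SC), letter (SC-an), END-GAME MAP v4 (line lead
K2E3-p14 (g3), `K2/STATUS.md` 2026-09-04T03:12:52Z: «(M5h) PACKAGING OWNER = K2E5-p04 (g3)»), piece (M5h) FILE A «WEIGHT KIT»: the model-side pieces of the domination
weight `W ≍ T⁻¹(1 + |log T|)` — the split shell bound with its binders paid at `L_w`, the shell index, continuity of the token, local integrability of `T⁻¹(1+|log T|)^k`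
(HC-D-ε ★ `hcd_model_rpow`) and of its height-weighted multiples.  2026-09-04.
-/
import Summits.HodgeConjecture.HodgeConjecture.Theorems.K2E3SupercuspidalTruncatedCharSplitBallPlace   -- ★ [M6′] FILE C p857009 (this seat); brings FILE B∕A, ★ (M5e-1) `…_le_shell`, ★ (M5a)+ quotient measures, ★ p856925, ★ (M5e-2)
import Summits.HodgeConjecture.HodgeConjecture.Theorems.K2E3HCDModelRpow                              -- ★ (ε6) p857001 (K2E3-p21): `hcd_model_rpow` — `T^{-4r} ∈ L¹_loc` on the place model, `12 r < 5`, HYPOTHESIS-FREE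
import Summits.HodgeConjecture.HodgeConjecture.Theorems.K2E3WeylDiscrLocIntRpow                        -- ★ (ε7) p856952 (K2E5-p01): `inv_coe_sqrt_sqrt_rpow_eq`, `enorm_coe_rpow_neg_le` (the real ∕ `ℝ≥0∞` dictionary)
import Summits.HodgeConjecture.HodgeConjecture.Theorems.K2E3LogWeightLocallyIntegrable                 -- ★ p856410 (K2E3-p20): `locallyIntegrable_inv_mul_log_pow` (`φ⁻¹(1+|log φ|)^k ∈ L¹_loc ⇐ (φ^{1+δ})⁻¹ ∈ L¹_loc`)
import Summits.HodgeConjecture.HodgeConjecture.Theorems.K2E3HCDGroupToLieRpow                          -- ★ (ε5) p856877 (K2E3-p21): `continuous_weylRatio_comp`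
import Summits.HodgeConjecture.HodgeConjecture.Theorems.F0P3cStCharTSHCDLocIntTransport                 -- ★ `locallyIntegrable_of_forall_exists_setLIntegral_lt_top`
import Literature.NumberTheory.Automorphic.AddCharConductorExponent                                     -- ★ `one_lt_residueFieldCard_nnreal`
import HarnessLib

/-!
# h413 ∕ Track B «K2-LIT», line `K2_E3_EllipticInputs`, unit U12, road (11-SC), letter (SC-an) — (M5h) FILE A «WEIGHT KIT» ON THE PLACE MODEL `U(σ_w, Φ₃)(L_w)`
# (Harish-Chandra 1970, Part VII §1 Theorem 15, §3 pp. 71–73; Theorems 14, 18–20)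

Cell `pub/hodgecm-mathlib`, crux H413 = `stmt-HodgeConjecture-24833`, route of record `HCCMUnconditional`; chair K2-lead (g0), dealer K2E3-plan (g2), (SC-an) line lead K2E3-p14 (g3).
THEOREMS ONLY (no `def`, no `instance`, no `notation`, no named-fact hypothesis, no `sorry`); lane `--supports stmt-HodgeConjecture-24833 --as helper`, count-neutral.

WHAT (the model-side inputs of the (M5h) packaging `W := W_M ∘ e`, `W_M(m) = K·(h(m)+1)·q^{h(m)}·T(m)⁻¹(1 + |log T(m)|)`, `h = Ω_M.find`, `T = √√(|disc χ|·|det|⁻²)`):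
* §1 **`exists_const_integral_heightBall_norm_conj_le_shell_place`** — ★ (M5e-1‴) `…_le_shell` with EVERY structural binder paid at `K = L_w` (`hunimod` ★ [M2a] (c), `K₁ hKB` ★ p856925,
  `ρ_T` ★ `exists_isHaarMeasure_torusU`, `μQ ≠ 0` ★ `exists_smulInvariantMeasure_quotient_torusU_place`, `σ_w ≠ id` ★ `exists_skew_ne_zero_adicCompletion`): for a Haar `ν` on
  `U(σ_w, J)(L_w)`, `J = Φ₃`, and `m_θ`, ONE `C` bounding `∫_{Ω R} ‖θ(x g x⁻¹)‖ dν ≤ C·M·(2(R + 42m + 2m_θ + 16τ) + 1)·q^m·T(g)⁻¹` on the shell `‖ϖ‖^τ ≤ T(g)`.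
* §2 `exists_shellIndex` — for `0 < t` a shell index `τ` with `‖ϖ‖^τ ≤ t` and `τ ≤ 1 + |log t| ∕ log q` (any non-archimedean local field, `|ϖ| = exp(−1)`).
* §3 `continuous_token` — `m ↦ T(m)` is continuous on `U(σ, J)(K)` (★ `continuous_weylRatio_comp`).
* §4 **`locallyIntegrable_inv_token_mul_log_pow`** — `T⁻¹(1 + |log T|)^k ∈ L¹_loc(U(σ_w, J)(L_w), ν)` for every Haar `ν` and every `k` (★ `hcd_model_rpow` at `r = 5∕16`, ★ (ε7)
  dictionary, ★ p856410).
* §5 `measurable_find`, **`locallyIntegrable_heightWeight`** — `m ↦ K·(h(m)+1)·q^{h(m)}·(T(m)⁻¹(1 + |log T(m)|)^k)` is locally integrable (the height factor is a locally bounded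
  measurable step function on the compact exhaustion).

HONEST LABEL.  HC_CM is proved only modulo the 7 printed citations (2 remaining named inputs: hLiu418 = `stmt-HodgeConjecture-24832`, h413 = `stmt-HodgeConjecture-24833`)
until rung 0 closes; count-neutral helper (measure-theoretic packaging; nothing printed is asserted as a fact).

## References
* [HarishChandra1970] Harish-Chandra (notes by G. van Dijk), *Harmonic Analysis on Reductive p-adic Groups*, LNM 162 (1970), Part VI §8 Theorem 14 p. 60; Part VII §1 Thm. 15
  p. 63, §2 Theorems 18–20 pp. 69–70, §3 pp. 71–73.
* [Rogawski1990] J. D. Rogawski, *Automorphic Representations of Unitary Groups in Three Variables*, Ann. of Math. Stud. 123 (1990), §4.9 p. 54, §7.3 p. 97, §12.5 p. 182.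
* [DeitmarEchterhoff2014] A. Deitmar, S. Echterhoff, *Principles of Harmonic Analysis*, 2nd ed. (2014), Thm. 1.5.3.
* [Folland1999] G. B. Folland, *Real Analysis* (2nd ed., 1999), §2.3, §3.3 (local integrability; products with locally bounded factors).
-/

set_option autoImplicit false
-- the mandated namespace repeats the single-problem summit's segment (`HodgeConjecture.HodgeConjecture`)
set_option linter.dupNamespace false

noncomputable section

open MeasureTheory Measure Set Filter Topology NumberField IsDedekindDomain
open scoped NNReal ENNReal Pointwise Matrix MatrixGroups WithZero
open ValuativeRel
open Literature.NumberTheory.Automorphic Literature.NumberTheory.Automorphic.UnitaryGroup Literature.NumberTheory.Rogawski1990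
open Literature.NumberTheory.GaloisRepresentations Literature.NumberTheory.GaloisRepresentations.IsNonarchimedeanLocalField

namespace Summit.HodgeConjecture.HodgeConjecture.Cruxes.H413.K2E3SupercuspidalTruncatedCharWeightKit

/-! ## §1 The split shell bound with its binders paid at the place -/

section Place

variable (L : Type) [Field L] [NumberField L] [IsCMField L] {v : HeightOneSpectrum (𝓞 ↥(maximalRealSubfield L))}
  (w : PlacesOver L v) (hw : IsCMField.complexConj L • w.1 = w.1)

/-- **(M5e-1‴) AT THE PLACE, BINDER-FREE**: on `U = U(σ_w, J)(L_w)`, `J = Φ₃`, with a Haar measure `ν`, the height balls `Ω` (`hmem` `hinv` `hmul`) and a support height `m_θ`, there is ONE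
`C : ℝ≥0` with, for every continuous `θ : U → E` supported in `Ω m_θ` and bounded by `M`, every `t = diag d ∈ T`, every `g = y t y⁻¹ ∈ Ω m`, every shell index `τ` with `‖ϖ‖^τ ≤ T(g)` and
every `R`: `∫_{Ω R} ‖θ(x g x⁻¹)‖ dν ≤ C·M·(2(R + 42m + 2m_θ + 16τ) + 1)·q^m·T(g)⁻¹` — ★ `exists_const_integral_heightBall_norm_conj_le_shell` with `hunimod` (★ [M2a] (c)), `K₁, hKB`
(★ `exists_isCompact_subgroup_mul_borelU_of_eq_over`), `ρ_T` (★ `exists_isHaarMeasure_torusU`), `μQ ≠ 0` (★ `exists_smulInvariantMeasure_quotient_torusU_place`), `σ_w ≠ id`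
(★ `exists_skew_ne_zero_adicCompletion`) discharged. [cite: HarishChandra1970, Part VII §3 pp. 71–72; Part VI §8 Theorem 14 p. 60] [cite: DeitmarEchterhoff2014, Thm. 1.5.3] -/
theorem exists_const_integral_heightBall_norm_conj_le_shell_place {J : Matrix (Fin 3) (Fin 3) (w.1.adicCompletion L)}
    (hJ : J = (StdForm.antidiagonal 3).over (w.1.adicCompletion L))
    [MeasurableSpace ↥(unitaryGroupOfForm (galAdicCompletionMap (L := L) (IsCMField.complexConj L) hw) J)]
    [BorelSpace ↥(unitaryGroupOfForm (galAdicCompletionMap (L := L) (IsCMField.complexConj L) hw) J)]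
    (ν : Measure ↥(unitaryGroupOfForm (galAdicCompletionMap (L := L) (IsCMField.complexConj L) hw) J)) [ν.IsHaarMeasure]
    (Ω : CompactExhaustion ↥(unitaryGroupOfForm (galAdicCompletionMap (L := L) (IsCMField.complexConj L) hw) J)) {ϖ : w.1.adicCompletion L}
    (hϖ : Valued.v ϖ = WithZero.exp (-1 : ℤ))
    (hmem : ∀ (m : ℕ) (g : ↥(unitaryGroupOfForm (galAdicCompletionMap (L := L) (IsCMField.complexConj L) hw) J)), g ∈ Ω m ↔
      (∀ i j, Valued.v (ϖ ^ m * ((g : GL (Fin 3) (w.1.adicCompletion L)) : Matrix (Fin 3) (Fin 3) (w.1.adicCompletion L)) i j) ≤ 1) ∧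
        ∀ i j, Valued.v (ϖ ^ m * (((g : GL (Fin 3) (w.1.adicCompletion L))⁻¹ : GL (Fin 3) (w.1.adicCompletion L)) :
          Matrix (Fin 3) (Fin 3) (w.1.adicCompletion L)) i j) ≤ 1)
    (hinv : ∀ (m : ℕ) (g : ↥(unitaryGroupOfForm (galAdicCompletionMap (L := L) (IsCMField.complexConj L) hw) J)), g ∈ Ω m → g⁻¹ ∈ Ω m)
    (hmul : ∀ (a b : ℕ) (g h : ↥(unitaryGroupOfForm (galAdicCompletionMap (L := L) (IsCMField.complexConj L) hw) J)), g ∈ Ω a → h ∈ Ω b → g * h ∈ Ω (a + b))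
    (mθ : ℕ) {E : Type*} [NormedAddCommGroup E] :
    ∃ C : ℝ≥0, ∀ (θ : ↥(unitaryGroupOfForm (galAdicCompletionMap (L := L) (IsCMField.complexConj L) hw) J) → E), Continuous θ → (∀ g, θ g ≠ 0 → g ∈ Ω mθ) →
      ∀ (M : ℝ≥0), (∀ g, ‖θ g‖₊ ≤ M) →
      ∀ (t : ↥(torusU (galAdicCompletionMap (L := L) (IsCMField.complexConj L) hw) J)) (d : Fin 3 → (w.1.adicCompletion L)ˣ),
        glDiagonal 3 (w.1.adicCompletion L) d = ((t : ↥(unitaryGroupOfForm (galAdicCompletionMap (L := L) (IsCMField.complexConj L) hw) J)) : GL (Fin 3) (w.1.adicCompletion L)) →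
        ∀ (g y : ↥(unitaryGroupOfForm (galAdicCompletionMap (L := L) (IsCMField.complexConj L) hw) J)) (m : ℕ), g ∈ Ω m →
          g = y * (t : ↥(unitaryGroupOfForm (galAdicCompletionMap (L := L) (IsCMField.complexConj L) hw) J)) * y⁻¹ →
        ∀ (τ : ℕ), normAbs (w.1.adicCompletion L) ϖ ^ τ ≤ NNReal.sqrt (NNReal.sqrt
            (normAbs (w.1.adicCompletion L) (((g : GL (Fin 3) (w.1.adicCompletion L)) : Matrix (Fin 3) (Fin 3) (w.1.adicCompletion L))).charpoly.discr *
              (normAbs (w.1.adicCompletion L) (((g : GL (Fin 3) (w.1.adicCompletion L)) : Matrix (Fin 3) (Fin 3) (w.1.adicCompletion L))).det ^ 2)⁻¹)) → ∀ (R : ℕ),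
          ∫ x in Ω R, ‖θ (x * g * x⁻¹)‖ ∂ν ≤
            C * M * ((2 * (R + 42 * m + 2 * mθ + 16 * τ) + 1 : ℕ) : ℝ) * ((residueFieldCard (w.1.adicCompletion L) : ℝ≥0) : ℝ) ^ m *
              ((NNReal.sqrt (NNReal.sqrt
                (normAbs (w.1.adicCompletion L) (((g : GL (Fin 3) (w.1.adicCompletion L)) : Matrix (Fin 3) (Fin 3) (w.1.adicCompletion L))).charpoly.discr *
                  (normAbs (w.1.adicCompletion L) (((g : GL (Fin 3) (w.1.adicCompletion L)) : Matrix (Fin 3) (Fin 3) (w.1.adicCompletion L))).det ^ 2)⁻¹)))⁻¹ : ℝ) := by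
  -- the frame of `L_w` and `U`
  letI : MeasurableSpace (w.1.adicCompletion L) := borel _
  haveI : BorelSpace (w.1.adicCompletion L) := ⟨rfl⟩
  haveI : SecondCountableTopology (w.1.adicCompletion L) := secondCountableTopology_adicCompletion L w.1
  haveI : CharZero (w.1.adicCompletion L) := charZero_of_injective_algebraMap (algebraMap L (w.1.adicCompletion L)).injective
  haveI : SecondCountableTopology ↥(unitaryGroupOfForm (galAdicCompletionMap (L := L) (IsCMField.complexConj L) hw) J) :=
    K2E3SupercuspModelFrameAtPlace.secondCountableTopology_unitaryGroupOfForm_adicCompletion L w _ J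
  haveI : LocallyCompactSpace ↥(unitaryGroupOfForm (galAdicCompletionMap (L := L) (IsCMField.complexConj L) hw) J) :=
    K2E3SupercuspModelFrameAtPlace.locallyCompactSpace_unitaryGroupOfForm_adicCompletion L w hw J
  haveI : ν.IsMulRightInvariant := K2E3SupercuspModelFrameAtPlace.isMulRightInvariant_of_isHaarMeasure_of_eq_over L w hw hJ ν
  have hσσ : ∀ x, galAdicCompletionMap (L := L) (IsCMField.complexConj L) hw (galAdicCompletionMap (L := L) (IsCMField.complexConj L) hw x) = x :=
    galAdicCompletionMap_galAdicCompletionMap_of_smul_eq (IsCMField.complexConj L) w (IsCMField.complexConj_ne_one L) hw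
  have hσc : Continuous (galAdicCompletionMap (L := L) (IsCMField.complexConj L) hw) := continuous_galAdicCompletionMap L (IsCMField.complexConj L) hw
  have hσv : ∀ x, Valued.v (galAdicCompletionMap (L := L) (IsCMField.complexConj L) hw x) = Valued.v x :=
    fun x => valued_galAdicCompletionMap (L := L) (IsCMField.complexConj L) hw x
  have hσ1 : ∃ x, galAdicCompletionMap (L := L) (IsCMField.complexConj L) hw x ≠ x := by
    obtain ⟨δ, hσδ, hδ⟩ := exists_skew_ne_zero_adicCompletion (IsCMField.complexConj L) (IsCMField.complexConj_ne_one L) w hw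
    refine ⟨δ, fun hfix => hδ ?_⟩
    have h2 : (2 : w.1.adicCompletion L) * δ = 0 := by linear_combination hfix.symm.trans hσδ
    exact (mul_eq_zero.mp h2).resolve_left two_ne_zero
  -- the torus `T`, its Haar measure, a non-zero invariant Radon measure on `U ⧸ T`, the Iwasawa compact
  haveI := K2E3SplitTorusQuotientMeasure.locallyCompactSpace_torusU (galAdicCompletionMap (L := L) (IsCMField.complexConj L) hw) J
  haveI := K2E3SplitTorusQuotientMeasure.secondCountableTopology_torusU (galAdicCompletionMap (L := L) (IsCMField.complexConj L) hw) J
  obtain ⟨ρT, hρT⟩ := K2E3SplitTorusQuotientMeasure.exists_isHaarMeasure_torusU (galAdicCompletionMap (L := L) (IsCMField.complexConj L) hw) J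
  haveI := hρT
  have hρ0 : ρT ≠ 0 := fun h => by
    have h1 := (isOpen_univ (X := ↥(torusU (galAdicCompletionMap (L := L) (IsCMField.complexConj L) hw) J))).measure_ne_zero ρT Set.univ_nonempty
    rw [h] at h1
    exact h1 rfl
  letI : MeasurableSpace (↥(unitaryGroupOfForm (galAdicCompletionMap (L := L) (IsCMField.complexConj L) hw) J) ⧸ torusU (galAdicCompletionMap (L := L) (IsCMField.complexConj L) hw) J) :=
    borel _
  haveI : BorelSpace (↥(unitaryGroupOfForm (galAdicCompletionMap (L := L) (IsCMField.complexConj L) hw) J) ⧸ torusU (galAdicCompletionMap (L := L) (IsCMField.complexConj L) hw) J) :=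
    ⟨rfl⟩
  obtain ⟨μQ, hQinv, hQfin, hQ0⟩ := K2E3SplitTorusQuotientMeasure.exists_smulInvariantMeasure_quotient_torusU_place L w hw hJ
  haveI := hQinv
  haveI := hQfin
  obtain ⟨K₁, hK₁, hKB⟩ := K2E3SplitTorusOrbitalBoundPlace.exists_isCompact_subgroup_mul_borelU_of_eq_over L w hw hJ
  exact K2E3SupercuspBallBoundSplitAssembly.exists_const_integral_heightBall_norm_conj_le_shell
    (galAdicCompletionMap (L := L) (IsCMField.complexConj L) hw) hσv hJ hσσ hσc hσ1 two_ne_zero hϖ ν ρT μQ Ω hmem hinv hmul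
    (fun ν' hν' => K2E3SupercuspModelFrameAtPlace.isMulRightInvariant_of_isHaarMeasure_of_eq_over L w hw hJ ν') hK₁ hKB hQ0 hρ0 mθ

end Place

/-! ## §2 The shell index: `‖ϖ‖^τ ≤ t` with `τ ≤ 1 + |log t| ∕ log q` -/

section Shell

variable {K : Type*} [Field K] [Valued K ℤᵐ⁰] [ValuativeRel K] [(Valued.v : Valuation K ℤᵐ⁰).Compatible] [IsNonarchimedeanLocalField K]

/-- **THE SHELL INDEX OF A POSITIVE TOKEN**: for `0 < t` there is `τ : ℕ` with `‖ϖ‖^τ ≤ t` (`‖ϖ‖ = q⁻¹`, ★ `normAbs_eq_inv_of_isUniformizingElement`) and `τ ≤ 1 + |log t| ∕ log q`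
— take `τ := ⌈log_q t⁻¹⌉₊` when `t < 1` and `τ := 0` otherwise.  (The `(1 + |λ(g)|)` of print, `q^{λ(g)} = |D(g)|`.) [cite: HarishChandra1970, Part VII §2 p. 69, §3 p. 72] -/
theorem exists_shellIndex {ϖ : K} (hϖ : Valued.v ϖ = WithZero.exp (-1 : ℤ)) {t : ℝ≥0} (ht : 0 < t) :
    ∃ τ : ℕ, normAbs K ϖ ^ τ ≤ t ∧ (τ : ℝ) ≤ 1 + |Real.log (t : ℝ)| / Real.log ((residueFieldCard K : ℝ≥0) : ℝ) := by
  have hq1 : (1 : ℝ) < ((residueFieldCard K : ℝ≥0) : ℝ) := by exact_mod_cast one_lt_residueFieldCard_nnreal (F := K)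
  have hq0 : (0 : ℝ) < ((residueFieldCard K : ℝ≥0) : ℝ) := zero_lt_one.trans hq1
  have hlogq : 0 < Real.log ((residueFieldCard K : ℝ≥0) : ℝ) := Real.log_pos hq1
  have hnorm : normAbs K ϖ = (residueFieldCard K : ℝ≥0)⁻¹ := normAbs_eq_inv_of_isUniformizingElement (isUniformizingElement_of_v_eq hϖ)
  by_cases ht1 : 1 ≤ t
  · refine ⟨0, by rw [pow_zero]; exact ht1, ?_⟩
    rw [Nat.cast_zero]
    exact add_nonneg zero_le_one (div_nonneg (abs_nonneg _) hlogq.le)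
  · rw [not_le] at ht1
    have ht' : (0 : ℝ) < t := by exact_mod_cast ht
    have ht1' : (t : ℝ) < 1 := by exact_mod_cast ht1
    have hlogt : Real.log (t : ℝ) < 0 := Real.log_neg ht' ht1'
    -- `τ := ⌈-log t / log q⌉₊`
    set x : ℝ := -Real.log (t : ℝ) / Real.log ((residueFieldCard K : ℝ≥0) : ℝ) with hx
    have hx0 : 0 ≤ x := div_nonneg (neg_nonneg.2 hlogt.le) hlogq.le
    refine ⟨⌈x⌉₊, ?_, ?_⟩
    · -- `q^{-τ} ≤ t` since `τ · log q ≥ -log t`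
      rw [hnorm, ← NNReal.coe_le_coe, NNReal.coe_pow, NNReal.coe_inv]
      have hτx : x ≤ (⌈x⌉₊ : ℝ) := Nat.le_ceil x
      have hle : -Real.log (t : ℝ) ≤ (⌈x⌉₊ : ℝ) * Real.log ((residueFieldCard K : ℝ≥0) : ℝ) := by
        rw [hx] at hτx
        rwa [div_le_iff₀ hlogq] at hτx
      rw [inv_pow, ← Real.rpow_natCast, ← Real.exp_log ht', ← Real.exp_log (Real.rpow_pos_of_pos hq0 _), ← Real.exp_neg, Real.exp_le_exp,
        Real.log_rpow hq0]
      linarith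
    · have h1 : (⌈x⌉₊ : ℝ) < x + 1 := Nat.ceil_lt_add_one hx0
      have h2 : x = |Real.log (t : ℝ)| / Real.log ((residueFieldCard K : ℝ≥0) : ℝ) := by rw [hx, abs_of_neg hlogt]
      linarith

end Shell

/-! ## §3 The token is continuous -/

section Token

variable {K : Type*} [Field K] [ValuativeRel K] [TopologicalSpace K] [IsNonarchimedeanLocalField K]

/-- **`m ↦ T(m) = √√(|disc χ_m| · |det m|⁻²)` IS CONTINUOUS ON `U(σ, J)(K)`** (★ `continuous_weylRatio_comp` at the inclusion `U ≤ GL₃(K)`, `NNReal.continuous_sqrt` twice).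
[cite: HarishChandra1970, Part VII §1 Thm. 15] [cite: Rogawski1990, §4.9 p. 54] -/
theorem continuous_token (σ : K →+* K) (J : Matrix (Fin 3) (Fin 3) K) :
    Continuous fun m : ↥(unitaryGroupOfForm σ J) => NNReal.sqrt (NNReal.sqrt
      (normAbs K (((m : GL (Fin 3) K) : Matrix (Fin 3) (Fin 3) K)).charpoly.discr *
        (normAbs K (((m : GL (Fin 3) K) : Matrix (Fin 3) (Fin 3) K)).det ^ 2)⁻¹)) :=
  NNReal.continuous_sqrt.comp (NNReal.continuous_sqrt.comp
    (K2E3HCDGroupToLieRpow.continuous_weylRatio_comp (unitaryGroupOfForm σ J).subtype continuous_subtype_val))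

end Token

/-! ## §4 `T⁻¹(1 + |log T|)^k` is locally integrable on the place model (HC-D-ε, ★ `hcd_model_rpow`) -/

section LocInt

variable (L : Type) [Field L] [NumberField L] [IsCMField L] {v : HeightOneSpectrum (𝓞 ↥(maximalRealSubfield L))}
  (w : PlacesOver L v) (hw : IsCMField.complexConj L • w.1 = w.1)

/-- **`(T^{1+δ})⁻¹ ∈ L¹_loc(U(σ_w, Φ₃)(L_w), ν)` at `δ = 1∕4`**, every Haar `ν`: ★ (ε6) `hcd_model_rpow` at `r = 5∕16` (`12r = 15∕4 < 5`) gives the neighbourhood bounds of the `ℝ≥0∞` token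
`(|disc χ|·|det|⁻²)^{-5∕16} = T^{-5∕4}`; ★ `locallyIntegrable_of_forall_exists_setLIntegral_lt_top` with the pointwise comparison ★ `enorm_coe_rpow_neg_le` and the identity ★
`inv_coe_sqrt_sqrt_rpow_eq` (`((√√x)^{1+δ})⁻¹ = x^{-(1+δ)∕4}`). [cite: HarishChandra1970, Part VII §1 Thm. 15 p. 63] -/
theorem locallyIntegrable_inv_token_rpow_five_quarters {J : Matrix (Fin 3) (Fin 3) (w.1.adicCompletion L)}
    (hJ : J = (StdForm.antidiagonal 3).over (w.1.adicCompletion L))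
    [MeasurableSpace ↥(unitaryGroupOfForm (galAdicCompletionMap (L := L) (IsCMField.complexConj L) hw) J)]
    [BorelSpace ↥(unitaryGroupOfForm (galAdicCompletionMap (L := L) (IsCMField.complexConj L) hw) J)]
    (ν : Measure ↥(unitaryGroupOfForm (galAdicCompletionMap (L := L) (IsCMField.complexConj L) hw) J)) [ν.IsHaarMeasure] :
    LocallyIntegrable (fun m : ↥(unitaryGroupOfForm (galAdicCompletionMap (L := L) (IsCMField.complexConj L) hw) J) =>
      ((((NNReal.sqrt (NNReal.sqrt
        (normAbs (w.1.adicCompletion L) (((m : GL (Fin 3) (w.1.adicCompletion L)) : Matrix (Fin 3) (Fin 3) (w.1.adicCompletion L))).charpoly.discr *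
          (normAbs (w.1.adicCompletion L) (((m : GL (Fin 3) (w.1.adicCompletion L)) : Matrix (Fin 3) (Fin 3) (w.1.adicCompletion L))).det ^ 2)⁻¹)) : ℝ≥0) : ℝ)) ^
        (1 + (1 / 4 : ℝ)))⁻¹) ν := by
  obtain rfl : J = placeForm (qsForm L) w.1 := hJ.trans (K2E3SupercuspModelFrameAtPlace.placeForm_qsForm_eq_over L w).symm
  have hr0 : (0 : ℝ) ≤ (1 + 1 / 4) / 4 := by norm_num
  have hr5 : 12 * ((1 + 1 / 4) / 4 : ℝ) < 5 := by norm_num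
  -- the real integrand, rewritten as a real power of the `√`-free token
  have heq : (fun m : ↥(unitaryGroupOfForm (galAdicCompletionMap (L := L) (IsCMField.complexConj L) hw) (placeForm (qsForm L) w.1)) =>
      ((((NNReal.sqrt (NNReal.sqrt
        (normAbs (w.1.adicCompletion L) (((m : GL (Fin 3) (w.1.adicCompletion L)) : Matrix (Fin 3) (Fin 3) (w.1.adicCompletion L))).charpoly.discr *
          (normAbs (w.1.adicCompletion L) (((m : GL (Fin 3) (w.1.adicCompletion L)) : Matrix (Fin 3) (Fin 3) (w.1.adicCompletion L))).det ^ 2)⁻¹)) : ℝ≥0) : ℝ)) ^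
        (1 + (1 / 4 : ℝ)))⁻¹) =
      fun m : ↥(unitaryGroupOfForm (galAdicCompletionMap (L := L) (IsCMField.complexConj L) hw) (placeForm (qsForm L) w.1)) =>
        (((normAbs (w.1.adicCompletion L) (((m : GL (Fin 3) (w.1.adicCompletion L)) : Matrix (Fin 3) (Fin 3) (w.1.adicCompletion L))).charpoly.discr *
          (normAbs (w.1.adicCompletion L) (((m : GL (Fin 3) (w.1.adicCompletion L)) : Matrix (Fin 3) (Fin 3) (w.1.adicCompletion L))).det ^ 2)⁻¹ : ℝ≥0) : ℝ)) ^
        (-((1 + 1 / 4) / 4 : ℝ)) := funext fun m => K2E3WeylDiscrLocIntRpow.inv_coe_sqrt_sqrt_rpow_eq _ _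
  rw [heq]
  have hcont : Continuous fun m : ↥(unitaryGroupOfForm (galAdicCompletionMap (L := L) (IsCMField.complexConj L) hw) (placeForm (qsForm L) w.1)) =>
      (normAbs (w.1.adicCompletion L) (((m : GL (Fin 3) (w.1.adicCompletion L)) : Matrix (Fin 3) (Fin 3) (w.1.adicCompletion L))).charpoly.discr *
          (normAbs (w.1.adicCompletion L) (((m : GL (Fin 3) (w.1.adicCompletion L)) : Matrix (Fin 3) (Fin 3) (w.1.adicCompletion L))).det ^ 2)⁻¹ : ℝ≥0) :=
    K2E3HCDGroupToLieRpow.continuous_weylRatio_comp (unitaryGroupOfForm _ _).subtype continuous_subtype_val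
  have hmeas : Measurable fun m : ↥(unitaryGroupOfForm (galAdicCompletionMap (L := L) (IsCMField.complexConj L) hw) (placeForm (qsForm L) w.1)) =>
      (((normAbs (w.1.adicCompletion L) (((m : GL (Fin 3) (w.1.adicCompletion L)) : Matrix (Fin 3) (Fin 3) (w.1.adicCompletion L))).charpoly.discr *
          (normAbs (w.1.adicCompletion L) (((m : GL (Fin 3) (w.1.adicCompletion L)) : Matrix (Fin 3) (Fin 3) (w.1.adicCompletion L))).det ^ 2)⁻¹ : ℝ≥0) : ℝ)) ^
        (-((1 + 1 / 4) / 4 : ℝ)) := (NNReal.continuous_coe.comp hcont).measurable.pow_const _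
  refine F0P3cStCharTSHCDLocIntTransport.locallyIntegrable_of_forall_exists_setLIntegral_lt_top hmeas.aestronglyMeasurable _
    (fun m => K2E3WeylDiscrLocIntRpow.enorm_coe_rpow_neg_le _ hr0) fun m => ?_
  exact K2E3HCDModelRpow.hcd_model_rpow L v w hw hr0 hr5 ν m

/-- **`T⁻¹ (1 + |log T|)^k ∈ L¹_loc(U(σ_w, Φ₃)(L_w), ν)`** for every Haar `ν` and every `k : ℕ` — ★ p856410 `locallyIntegrable_inv_mul_log_pow` (`φ := T` continuous, §3) on the previous
theorem (`δ = 1∕4`).  This is the `hW` input of ★ p856355 on the model, with room for any polynomial-in-`log` factor. [cite: HarishChandra1970, Part VII §1 Thm. 15 p. 63; §3 p. 73] -/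
theorem locallyIntegrable_inv_token_mul_log_pow {J : Matrix (Fin 3) (Fin 3) (w.1.adicCompletion L)}
    (hJ : J = (StdForm.antidiagonal 3).over (w.1.adicCompletion L))
    [MeasurableSpace ↥(unitaryGroupOfForm (galAdicCompletionMap (L := L) (IsCMField.complexConj L) hw) J)]
    [BorelSpace ↥(unitaryGroupOfForm (galAdicCompletionMap (L := L) (IsCMField.complexConj L) hw) J)]
    (ν : Measure ↥(unitaryGroupOfForm (galAdicCompletionMap (L := L) (IsCMField.complexConj L) hw) J)) [ν.IsHaarMeasure] (k : ℕ) :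
    LocallyIntegrable (fun m : ↥(unitaryGroupOfForm (galAdicCompletionMap (L := L) (IsCMField.complexConj L) hw) J) =>
      (((NNReal.sqrt (NNReal.sqrt
        (normAbs (w.1.adicCompletion L) (((m : GL (Fin 3) (w.1.adicCompletion L)) : Matrix (Fin 3) (Fin 3) (w.1.adicCompletion L))).charpoly.discr *
          (normAbs (w.1.adicCompletion L) (((m : GL (Fin 3) (w.1.adicCompletion L)) : Matrix (Fin 3) (Fin 3) (w.1.adicCompletion L))).det ^ 2)⁻¹)) : ℝ≥0) : ℝ))⁻¹ *
        (1 + |Real.log (((NNReal.sqrt (NNReal.sqrt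
          (normAbs (w.1.adicCompletion L) (((m : GL (Fin 3) (w.1.adicCompletion L)) : Matrix (Fin 3) (Fin 3) (w.1.adicCompletion L))).charpoly.discr *
            (normAbs (w.1.adicCompletion L) (((m : GL (Fin 3) (w.1.adicCompletion L)) : Matrix (Fin 3) (Fin 3) (w.1.adicCompletion L))).det ^ 2)⁻¹)) : ℝ≥0) : ℝ))|) ^ k) ν := by
  haveI : LocallyCompactSpace ↥(unitaryGroupOfForm (galAdicCompletionMap (L := L) (IsCMField.complexConj L) hw) J) :=
    K2E3SupercuspModelFrameAtPlace.locallyCompactSpace_unitaryGroupOfForm_adicCompletion L w hw J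
  exact K2E3LogWeightLocallyIntegrable.locallyIntegrable_inv_mul_log_pow ν (continuous_token _ J) (by norm_num : (0 : ℝ) < 1 / 4) k
    (locallyIntegrable_inv_token_rpow_five_quarters L w hw hJ ν)

end LocInt

/-! ## §5 The height factor: a locally bounded measurable step function; height-weighted local integrability -/

section Height

variable {X : Type*} [TopologicalSpace X] [MeasurableSpace X] [BorelSpace X] [T2Space X]

open scoped Classical in
/-- **`x ↦ h(x) := Ω.find x` (the minimal height) is measurable** — `{h ≤ n} = Ω n` is closed (Mathlib `measurable_find`). [cite: Folland1999, §2.3] -/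
theorem measurable_find (Ω : CompactExhaustion X) : Measurable fun x => Ω.find x := by
  unfold CompactExhaustion.find
  exact _root_.measurable_find _ fun k => (Ω.isCompact k).isClosed.measurableSet

/-- **HEIGHT-WEIGHTED LOCAL INTEGRABILITY**: if `f` is locally integrable, so is `x ↦ A · (h(x) + 1) · q^{h(x)} · f(x)` for `0 ≤ A`, `1 ≤ q` (`h = Ω.find`): on the compact ball `Ω (h(x₀)+1)`,
a neighbourhood of `x₀`, the factor is measurable and bounded by `A (h(x₀) + 2) q^{h(x₀)+1}` (Mathlib `Integrable.bdd_mul`). [cite: Folland1999, §2.3, §3.3] -/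
theorem locallyIntegrable_heightWeight (μ : Measure X) (Ω : CompactExhaustion X) {f : X → ℝ} (hf : LocallyIntegrable f μ) {A q : ℝ} (hA : 0 ≤ A) (hq : 1 ≤ q) :
    LocallyIntegrable (fun x => A * ((Ω.find x : ℝ) + 1) * q ^ (Ω.find x) * f x) μ := by
  intro x₀
  set n₀ : ℕ := Ω.find x₀ with hn₀
  -- the compact ball `Ω (n₀ + 1)` is a neighbourhood of `x₀`
  have hK : (Ω (n₀ + 1) : Set X) ∈ 𝓝 x₀ :=
    mem_of_superset (isOpen_interior.mem_nhds (Ω.subset_interior_succ n₀ (Ω.mem_find x₀))) interior_subset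
  refine ⟨Ω (n₀ + 1), hK, ?_⟩
  have hfK : IntegrableOn f (Ω (n₀ + 1)) μ := hf.integrableOn_isCompact (Ω.isCompact (n₀ + 1))
  -- the factor is measurable (a function of the measurable `h`) and bounded on the ball
  have hmeas : Measurable fun x => A * ((Ω.find x : ℝ) + 1) * q ^ (Ω.find x) :=
    (measurable_from_nat (f := fun n : ℕ => A * ((n : ℝ) + 1) * q ^ n)).comp (measurable_find Ω)
  have hbd : ∀ᵐ x ∂μ.restrict (Ω (n₀ + 1)), ‖A * ((Ω.find x : ℝ) + 1) * q ^ (Ω.find x)‖ ≤ A * ((n₀ : ℝ) + 2) * q ^ (n₀ + 1) := by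
    refine ae_restrict_of_forall_mem (Ω.isCompact (n₀ + 1)).isClosed.measurableSet fun x hx => ?_
    have hle : Ω.find x ≤ n₀ + 1 := Ω.mem_iff_find_le.1 hx
    have hq0 : (0 : ℝ) ≤ q := zero_le_one.trans hq
    rw [Real.norm_of_nonneg (mul_nonneg (mul_nonneg hA (by positivity)) (pow_nonneg hq0 _))]
    have h1 : ((Ω.find x : ℝ) + 1) ≤ (n₀ : ℝ) + 2 := by
      have : (Ω.find x : ℝ) ≤ (n₀ : ℝ) + 1 := by exact_mod_cast hle
      linarith
    have h2 : q ^ (Ω.find x) ≤ q ^ (n₀ + 1) := pow_le_pow_right₀ hq hle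
    exact mul_le_mul (mul_le_mul_of_nonneg_left h1 hA) h2 (pow_nonneg hq0 _) (mul_nonneg hA (by positivity))
  exact Integrable.bdd_mul hfK hmeas.aestronglyMeasurable hbd

end Height

end Summit.HodgeConjecture.HodgeConjecture.Cruxes.H413.K2E3SupercuspidalTruncatedCharWeightKit

end
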